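import Mathlib
import Summits.Ventures.PercRepro2.Defs
import Summits.Ventures.PercRepro2.Graph
import Summits.Ventures.PercRepro2.Harris
import Summits.Ventures.PercRepro2.Events
import Summits.Ventures.PercRepro2.Independence
import Summits.Ventures.PercRepro2.Induced
import Summits.Ventures.PercRepro2.Exploration
import Summits.Ventures.PercRepro2.GateDefs
import Summits.Ventures.PercRepro2.GateAnatomy
import Summits.Ventures.PercRepro2.GateForest
import Summits.Ventures.PercRepro2.GateLSM
import Summits.Ventures.PercRepro2.GateSplit
import Summits.Ventures.PercRepro2.GateSplitForest
import Summits.Ventures.PercRepro2.HullTree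
import Summits.Ventures.PercRepro2.GateFeedbackForest
import Summits.Ventures.PercRepro2.GateFeedback
import Summits.Ventures.PercRepro2.GateFeedbackExit
import Summits.Ventures.PercRepro2.GateFeedbackGeneral
import Summits.Ventures.PercRepro2.GateContract
import Summits.Ventures.PercRepro2.GateShadow
import Summits.Ventures.PercRepro2.GateSide
import Summits.Ventures.PercRepro2.GateSep
import Summits.Ventures.PercRepro2.GateNear
import Summits.Ventures.PercRepro2.GateRestrict
import Summits.Ventures.PercRepro2.GateSepGeneral
import Summits.Ventures.PercRepro2.SideCluster
import Summits.Ventures.PercRepro2.CactusDefs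
import Summits.Ventures.PercRepro2.CactusTriangle
import Summits.Ventures.PercRepro2.CactusTriangleMass
import Summits.Ventures.PercRepro2.CactusCluster
import Summits.Ventures.PercRepro2.CactusDel
import Summits.Ventures.PercRepro2.CactusChain
import Summits.Ventures.PercRepro2.CactusKappa
import Summits.Ventures.PercRepro2.CactusGate

/-!
# THEOREM 2 for every entry set, and on the near region (blind cell PercRepro2, mine-c g11;
proofs/MINEC-FEEDBACK.md §14)

The `(GATE A,{w})` twins of `CactusGate.lean`: the class-`A₂` mass of the gate with entry set `A`
factorises as `1[t,w ∉ W, W ∩ A = ∅] · P(C(s) = W) · κ(W)` (`GateSepGeneral.massA₂_eq_connDel`),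
so `CactusGate.core_lsm` gives its FKG lattice condition when `G − t` is a triangular cactus
(`massA₂LogSupermod_of_isCactus_del`), hence `Gate.GateRow s {t} a b A {w}` for every entry set
(`gateRow_general_of_isCactus_del`, exit version `gateRow_general_of_isCactus_del_exit`, the
separator forms). With the near-region reduction of g10 (`GateRestrict.massBLogSupermod_of_restrict`,
`GateSepGeneral.massA₂LogSupermod_of_restrict`) the cactus hypothesis is only needed on the edges
inside the near region of `(s, t, w)` not at `t` (resp. not at `w`): everything beyond `t` and
beyond `w` is arbitrary (`gateRow_of_isCactus_near`, `gateRow_of_isCactus_near_exit`,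
`gateRow_general_of_isCactus_near`, `gateRow_general_of_isCactus_near_exit`).
-/

namespace Summit.Ventures.PercRepro2

namespace CactusGate

open Cactus CactusChain GateSide

open scoped Classical

variable {V : Type*} {E : Type*} [Fintype E] [Fintype V]
variable {R : Type*} [Field R] [LinearOrder R] [IsStrictOrderedRing R]
variable {ends : E → Sym2 V}

/-! ## Every entry set -/

/-- **THEOREM 2 for every entry set, FKG form.** If `G − t` is a triangular cactus built from the
root, the class-`A₂` mass of the gate with entry set `A` and exit `w` is log-supermodular. -/
theorem massA₂LogSupermod_of_isCactus_del {p : E → R} (hp : IsProbVec p) {s t w : V}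
    (A : Finset V) (hF : IsCactusFrom ends s (GateFeedback.Ft ends t)) (hw : w ≠ t) :
    GateSplit.MassA₂LogSupermod p ends s t A {w} := by
  intro W₁ W₂
  have hnn : ∀ W, 0 ≤ GateSplit.massA₂ p ends s t A {w} W := fun W => prob_nonneg hp _
  by_cases h₁ : t ∈ W₁ ∨ w ∈ W₁ ∨ ∃ x ∈ A, x ∈ W₁
  · rw [GateSepGeneral.massA₂_eq_connDel p ends s t w A W₁, if_pos h₁, zero_mul]
    exact mul_nonneg (hnn _) (hnn _)
  by_cases h₂ : t ∈ W₂ ∨ w ∈ W₂ ∨ ∃ x ∈ A, x ∈ W₂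
  · rw [GateSepGeneral.massA₂_eq_connDel p ends s t w A W₂, if_pos h₂, mul_zero]
    exact mul_nonneg (hnn _) (hnn _)
  simp only [not_or, not_exists, not_and] at h₁ h₂
  obtain ⟨ht₁, hw₁, hA₁⟩ := h₁
  obtain ⟨ht₂, hw₂, hA₂⟩ := h₂
  have hI : ¬ (t ∈ W₁ ∩ W₂ ∨ w ∈ W₁ ∩ W₂ ∨ ∃ x ∈ A, x ∈ W₁ ∩ W₂) := by
    rintro (h | h | ⟨x, hxA, hx⟩)
    · exact ht₁ (Finset.mem_inter.1 h).1
    · exact hw₁ (Finset.mem_inter.1 h).1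
    · exact hA₁ x hxA (Finset.mem_inter.1 hx).1
  have hU : ¬ (t ∈ W₁ ∪ W₂ ∨ w ∈ W₁ ∪ W₂ ∨ ∃ x ∈ A, x ∈ W₁ ∪ W₂) := by
    rintro (h | h | ⟨x, hxA, hx⟩)
    · rcases Finset.mem_union.1 h with h | h
      · exact ht₁ h
      · exact ht₂ h
    · rcases Finset.mem_union.1 h with h | h
      · exact hw₁ h
      · exact hw₂ h
    · rcases Finset.mem_union.1 hx with h | h
      · exact hA₁ x hxA h
      · exact hA₂ x hxA h
  rw [GateSepGeneral.massA₂_eq_connDel p ends s t w A W₁,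
    GateSepGeneral.massA₂_eq_connDel p ends s t w A W₂,
    GateSepGeneral.massA₂_eq_connDel p ends s t w A (W₁ ∩ W₂),
    GateSepGeneral.massA₂_eq_connDel p ends s t w A (W₁ ∪ W₂),
    if_neg (by simp only [not_or, not_exists, not_and]; exact ⟨ht₁, hw₁, hA₁⟩),
    if_neg (by simp only [not_or, not_exists, not_and]; exact ⟨ht₂, hw₂, hA₂⟩), if_neg hI, if_neg hU]
  exact core_lsm hp hF hw ht₁ ht₂ hw₁ hw₂

/-- **THEOREM 2′ for every entry set, FKG form** (`G − w` a triangular cactus). -/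
theorem massA₂LogSupermod_of_isCactus_del_exit {p : E → R} (hp : IsProbVec p) {s t w : V}
    (A : Finset V) (hF : IsCactusFrom ends s (GateFeedback.Ft ends w)) (hw : w ≠ t) :
    GateSplit.MassA₂LogSupermod p ends s t A {w} :=
  GateSepGeneral.massA₂LogSupermod_comm (massA₂LogSupermod_of_isCactus_del hp A hF hw.symm)

/-- **THEOREM 2 for every entry set**: `G − t` a triangular cactus ⟹ `(GATE A,{w})`. -/
theorem gateRow_general_of_isCactus_del {p : E → R} (hp : IsProbVec p) (s t a b w : V)
    (A : Finset V) (hF : IsCactusFrom ends s (GateFeedback.Ft ends t)) (hw : w ≠ t) :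
    Gate.GateRow p ends s {t} a b A {w} :=
  GateSplitForest.gateRow_of_massA₂_logSupermod p ends s t a b A {w} hp
    (massA₂LogSupermod_of_isCactus_del hp A hF hw)

/-- **THEOREM 2′ for every entry set**: `G − w` a triangular cactus ⟹ `(GATE A,{w})`. -/
theorem gateRow_general_of_isCactus_del_exit {p : E → R} (hp : IsProbVec p) (s t a b w : V)
    (A : Finset V) (hF : IsCactusFrom ends s (GateFeedback.Ft ends w)) (hw : w ≠ t) :
    Gate.GateRow p ends s {t} a b A {w} :=
  GateSplitForest.gateRow_of_massA₂_logSupermod p ends s t a b A {w} hp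
    (massA₂LogSupermod_of_isCactus_del_exit hp A hF hw)

/-- Every cycle through a separator `z` between the exit and the avoided vertex, cactus base,
every entry set. -/
theorem gateRow_general_of_sep_exit_of_isCactus_del_exit {p : E → R} (hp : IsProbVec p)
    (s t a b w z : V) (A : Finset V) (hsep : w ∉ side ends z t) (hside : w ∉ side ends z s)
    (hwz : w ≠ z) (htz : t ≠ z) (hF : IsCactusFrom ends s (GateFeedback.Ft ends z)) :
    Gate.GateRow p ends s {t} a b A {w} :=
  GateSepGeneral.gateRow_general_of_sep_exit hp s t a b w z A hsep hside hwz htz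
    (massA₂LogSupermod_of_isCactus_del_exit hp A hF htz.symm)

/-- Every cycle through a separator `z` between the avoided vertex and the exit, cactus base,
every entry set. -/
theorem gateRow_general_of_sep_avoid_of_isCactus_del {p : E → R} (hp : IsProbVec p)
    (s t a b w z : V) (A : Finset V) (hsep : t ∉ side ends z w) (hside : t ∉ side ends z s)
    (htz : t ≠ z) (hwz : w ≠ z) (hF : IsCactusFrom ends s (GateFeedback.Ft ends z)) :
    Gate.GateRow p ends s {t} a b A {w} :=
  GateSepGeneral.gateRow_general_of_sep_avoid hp s t a b w z A hsep hside htz hwz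
    (massA₂LogSupermod_of_isCactus_del hp A hF hwz)

/-! ## The near region decides, cactus base -/

/-- **THEOREM (the near region decides, cactus base).** If the edges inside the near region of
`(s, t, w)` not at `t` form a triangular cactus built from the root, the free one-sided gate holds;
everything beyond `t` and beyond `w` is arbitrary. -/
theorem gateRow_of_isCactus_near {p : E → R} (hp : IsProbVec p) (s t a b u w : V) (hst : s ≠ t)
    (hsw : s ≠ w) (htw : t ≠ w)
    (hF : IsCactusFrom (GateNear.endsR (GateNear.nearEdges ends s t w) ends) s
      (GateFeedback.Ft (GateNear.endsR (GateNear.nearEdges ends s t w) ends) t)) :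
    Gate.GateRow p ends s {t} a b {u} {w} := by
  have h1 := massBLogSupermod_of_isCactus_del (s := s) (u := u)
    (GateNear.IsProbVec.pR (GateNear.nearEdges ends s t w) hp) hF htw.symm
  have h2 := GateRestrict.massBLogSupermod_of_restrict hst hsw htw h1
  exact GateSep.gateRow_of_massBLogSupermod hp s t a b u w h2

/-- **The near region decides, cactus base, exit version.** -/
theorem gateRow_of_isCactus_near_exit {p : E → R} (hp : IsProbVec p) (s t a b u w : V)
    (hst : s ≠ t) (hsw : s ≠ w) (htw : t ≠ w)
    (hF : IsCactusFrom (GateNear.endsR (GateNear.nearEdges ends s t w) ends) s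
      (GateFeedback.Ft (GateNear.endsR (GateNear.nearEdges ends s t w) ends) w)) :
    Gate.GateRow p ends s {t} a b {u} {w} := by
  have h1 := massBLogSupermod_of_isCactus_del_exit (s := s) (u := u)
    (GateNear.IsProbVec.pR (GateNear.nearEdges ends s t w) hp) hF htw.symm
  have h2 := GateRestrict.massBLogSupermod_of_restrict hst hsw htw h1
  exact GateSep.gateRow_of_massBLogSupermod hp s t a b u w h2

/-- **The near region decides, cactus base, every entry set.** -/
theorem gateRow_general_of_isCactus_near {p : E → R} (hp : IsProbVec p) (s t a b w : V)
    (A : Finset V) (hst : s ≠ t) (hsw : s ≠ w) (htw : t ≠ w)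
    (hF : IsCactusFrom (GateNear.endsR (GateNear.nearEdges ends s t w) ends) s
      (GateFeedback.Ft (GateNear.endsR (GateNear.nearEdges ends s t w) ends) t)) :
    Gate.GateRow p ends s {t} a b A {w} := by
  have h1 := massA₂LogSupermod_of_isCactus_del (s := s)
    (GateNear.IsProbVec.pR (GateNear.nearEdges ends s t w) hp) A hF htw.symm
  have h2 := GateSepGeneral.massA₂LogSupermod_of_restrict hst hsw htw h1
  exact GateSplitForest.gateRow_of_massA₂_logSupermod p ends s t a b A {w} hp h2

/-- **The near region decides, cactus base, every entry set, exit version.** -/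
theorem gateRow_general_of_isCactus_near_exit {p : E → R} (hp : IsProbVec p) (s t a b w : V)
    (A : Finset V) (hst : s ≠ t) (hsw : s ≠ w) (htw : t ≠ w)
    (hF : IsCactusFrom (GateNear.endsR (GateNear.nearEdges ends s t w) ends) s
      (GateFeedback.Ft (GateNear.endsR (GateNear.nearEdges ends s t w) ends) w)) :
    Gate.GateRow p ends s {t} a b A {w} := by
  have h1 := massA₂LogSupermod_of_isCactus_del_exit (s := s)
    (GateNear.IsProbVec.pR (GateNear.nearEdges ends s t w) hp) A hF htw.symm
  have h2 := GateSepGeneral.massA₂LogSupermod_of_restrict hst hsw htw h1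
  exact GateSplitForest.gateRow_of_massA₂_logSupermod p ends s t a b A {w} hp h2

end CactusGate

end Summit.Ventures.PercRepro2
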